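import Summits.QuantumFields.BalabanUV.Beta.SymRootedJetLinear
import Summits.QuantumFields.BalabanUV.Beta.RootedJetReflectionExpanded

/-!
# `BalabanUV.Beta.SymRootedJetReflectionExpanded` — THE `Ad`-EXPANSION OF THE REFLECTED (0.4)-SYMMETRISED ROOTED JET `symQjetLAt ρ ω♯` BY COMPONENTS
# (β sub-cell, row D1, TABLES-SYM-LEAN S2c, INTERFACE-LEVEL twin of an3's `RootedJetReflectionExpanded` §3; an1 gen 43)

HONEST FRAMING (cell charter, verbatim): «discharging BetaPertH makes Bałaban's UV stability UNCONDITIONAL — a real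
constructive-QFT result; it is NOT the continuum limit and NOT the Clay problem.»  HONEST DEPENDENCY (verbatim): «continuum YM on
T⁴ ⇐ BetaPertH ∧ nine spine estimates (0/9 proved); BetaPertH ⇐ (D1) ∧ (D4) ∧ CAP+tail; G-an2-4 gates asym, D1 and NE2/3/4.»
ABSOLUTE RULE (R-g25-7 ∕ R-D1-g30-1 (A)): the (0.4)-symmetrised averaging is the exp of the MEAN OF LOGS over the pair family
`{loop^{σ,σ′}}` with weight `((d!)²·L^d)⁻¹`; every object below is the comb module's algebra read on an1's `symPhiGAt` (S2b part 1)
instead of `PhiGAt` — STATEMENT FOR STATEMENT under the dictionary `PhiXAt ↦ symPhiXAt`, `XjetAt ↦ symXjetAt`, `MσXAt ↦ symMσXAt`,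
`L^{-d}·linAvgAt ↦ (d!·L^d)⁻¹·symLinU`, `L^{-d}·hessUAt ↦ ((d!)²L^d)⁻¹·symHessUAt`, `L^{-2d}·vhUAt ↦ ((d!)²L^{2d})⁻¹·symVhUAt`
(an3-g63 [AN3-G63-S2C] (C-ii): constants PER BCH ORDER; CONVENTION `(d!)²` un-normalised inside order-2 sym functionals).
FAMILY-INDEPENDENT chart ∕ letter ∕ `Tau`-algebra lemmas of the comb module are imported BY NAME, never re-proved.
DERIVED cell leaf: [folklore] ring algebra; the `sym*` families are [our object]s.  No statement of Bałaban's papers is typed here, no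
`[cite:]` tag, no `Prop` is minted, no binder of the β-function wall (`hW`/`hR`/`D1Tel`/`D1Rep`, (D1), `BetaPertH`) is instantiated or
discharged; nothing about the VALUES of `symMixFFAt`∕`symVh₂SAt` and no (T2-B)∕(T2-M₂) letter is discharged in this file.
NOT D1, NOT BetaPertH, NOT continuum, NOT Clay.  NOT summit progress.
Provenance: β sub-cell, TABLES-SYM-LEAN S2c option (C) (S2C-SCOPE-v1 94facb80ac685517), unit b2b-balaban-beta-an1-g43 (W-supplier AN1,
FREEZE (0): scratch for a courier; an1 files nothing), 2026-08-21; no existing file touched.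

## What this module proves (sym twin of `RootedJetReflectionExpanded` §3 only; §1–§2 — `dR`, `reflPair_Ebg_Ebi`∕`_Ebi_Ebg`, `ad1R`, `ad12R`, `omegaR_eq`, … — are
## family-independent letter algebra, the comb module's BY NAME)
* `symQjetLAt_omegaR`: `symQ(ω♯) = symQ(w) + τ₁ symQ(ad1R b) + τ₂ symQ(ad1R c) + τ₁τ₂ symQ(ad12R)`; `c11_symQjetLAt_omegaR` its `τ₁τ₂`-component.
-/

namespace Summit.QuantumFields.BalabanUV.Beta.SymRootedJetReflectionExpanded

open Literature.MathematicalPhysics.QuantumFieldTheory.Balaban1983to89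
open Literature.MathematicalPhysics.QuantumFieldTheory.Balaban1983to89.Beta
open AffineAveraging (Form1)
open AveragingThirdJet (Tau Ebg Ebi)
open AveragingThirdJet.Tau (τ₁ τ₂ τ12 ι c00 c10 c01 c11 ext4 c11_add c11_τ₁_mul c11_τ₂_mul c11_τ12_mul)
open ResolventReflection (sref bref)
open Summit.QuantumFields.BalabanUV.Beta.RootedHolonomyReflection (R1g R1g_of_ne)
open Summit.QuantumFields.BalabanUV.Beta.RootedHolonomyReflectionHol (reflPair reflPair_of_ne reflPair_self)
open Summit.QuantumFields.BalabanUV.Beta.RootedJetReflection (omegaR omegaR_of_ne omegaR_self)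
open Summit.QuantumFields.BalabanUV.Beta.SymRootedJetReflection (symQjetLAt)
open Summit.QuantumFields.BalabanUV.Beta.SymRootedJetLinear (symQjetLAt_add symQjetLAt_τ₁_mul symQjetLAt_τ₂_mul symQjetLAt_τ12_mul)
open Summit.QuantumFields.BalabanUV.Beta.RootedJetReflectionExpanded (dR dR_of_ne dR_self dR_swap reflPair_Ebg_Ebi reflPair_Ebi_Ebg ad1R ad12R ad1R_of_ne
  ad12R_of_ne ad1R_self ad12R_self ad1R_zero ad12R_zero omegaR_eq)

variable {d : ℕ} {𝔸 : Type*} [Ring 𝔸]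

/-! ## §1–§2 (the reflected background pair `dR`∕`reflPair_Ebg_Ebi` and the letters `ad1R`∕`ad12R`∕`omegaR_eq`: the comb module's, BY NAME) -/

/-! ## §3 The reflected symmetrised jet by components -/

variable (𝕜 : Type*) [Field 𝕜] [Algebra 𝕜 𝔸]

/-- [folklore] **THE `Ad`-EXPANSION OF THE REFLECTED JET** (any background letter pair `(E, Ē)`, any root):
`Q(ω♯) = Q(w) + τ₁ Q(ad1R b) + τ₂ Q(ad1R c) + τ₁τ₂ Q(ad12R)`. -/
theorem symQjetLAt_omegaR (ρ : Fin d → ℤ) (α : Fin d) (ω : Form1 d (Tau 𝔸)) (B B' : Form1 d 𝔸) (E Eb : Form1 d (Tau 𝔸)) (L : ℕ)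
    (μ : Fin d) (y : Fin d → ℤ) :
    symQjetLAt 𝕜 ρ (omegaR α ω B B') E Eb L μ y
      = symQjetLAt 𝕜 ρ (R1g α ω) E Eb L μ y + τ₁ * symQjetLAt 𝕜 ρ (ad1R α ω B) E Eb L μ y + τ₂ * symQjetLAt 𝕜 ρ (ad1R α ω B') E Eb L μ y
        + τ12 * symQjetLAt 𝕜 ρ (ad12R α ω B B') E Eb L μ y := by
  rw [omegaR_eq, symQjetLAt_add, symQjetLAt_add, symQjetLAt_add, symQjetLAt_τ₁_mul, symQjetLAt_τ₂_mul, symQjetLAt_τ12_mul]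

/-- [folklore] **ITS `τ₁τ₂`-COMPONENT**: `c11 Q(ω♯) = c11 Q(w) + c01 Q(ad1R b) + c10 Q(ad1R c) + c00 Q(ad12R)`. -/
theorem c11_symQjetLAt_omegaR (ρ : Fin d → ℤ) (α : Fin d) (ω : Form1 d (Tau 𝔸)) (B B' : Form1 d 𝔸) (E Eb : Form1 d (Tau 𝔸))
    (L : ℕ) (μ : Fin d) (y : Fin d → ℤ) :
    c11 (symQjetLAt 𝕜 ρ (omegaR α ω B B') E Eb L μ y)
      = c11 (symQjetLAt 𝕜 ρ (R1g α ω) E Eb L μ y) + c01 (symQjetLAt 𝕜 ρ (ad1R α ω B) E Eb L μ y)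
        + c10 (symQjetLAt 𝕜 ρ (ad1R α ω B') E Eb L μ y) + c00 (symQjetLAt 𝕜 ρ (ad12R α ω B B') E Eb L μ y) := by
  rw [symQjetLAt_omegaR, c11_add, c11_add, c11_add, c11_τ₁_mul, c11_τ₂_mul, c11_τ12_mul]

end Summit.QuantumFields.BalabanUV.Beta.SymRootedJetReflectionExpanded
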